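import Summits.QuantumFields.YangMills.Theorems.BalabanUVNodesN15CurvedGluingSmoothCutDressedGluedAdjointRightInverseDefectFlat
import Summits.QuantumFields.YangMills.Theorems.BalabanUVNodesN15CurvedGluingCubeSmoothCutDressedDefect
import HarnessLib

/-!
# ENTRY 2 `Y∘∇⁻_ν` AT TWO SPACINGS FROM FLAT DATA, THE DRESSED CUT CUBE's η-DEFECT DERIVED — n15-c∕174 ★★★ with its displayed defect `𝔇(X′_k, X_k)` PRODUCED by dag-n15-w3 file 36
# `hasMaj_idef_smoothCutDressed_loc₂` from the cut cube rows' η-defects, the bumps' two-grid fits and the species' η-defect (dag-n15-c g19, n15-c∕174b; N15 = NE2, s1 road (c))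

Cell `pub-ymgap`, seat `pub-ymgap-dag-n15-c` (R134 (a); HUMAN RULING D-0062), generation 19.  `bears_on: R4∕N15 · K3⁸ SpineGivenEndpointR13SepCoPHV (stmt-QuantumFields-27366)`.
Filed `--kind proof --supports stmt-QuantumFields-27366 --as helper` — COUNT-NEUTRAL.  Theorems only; 0 `def`, 0 `sorry`.  Imports BY NAME n15-c∕174 `…GluedAdjointRightInverseDefectFlat`
(★★★ `hasMaj_idef_rightInverse_bgrad_smoothCutDressed_of_flat`) and dag-n15-w3 file 36 `…CurvedGluingCubeSmoothCutDressedDefect` (★ `hasMaj_idef_smoothCutDressed_loc₂`).  Nothing restated.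

WHAT.  ★★★ `hasMaj_idef_rightInverse_bgrad_smoothCutDressed_of_flat_cut` — n15-c∕174 VERBATIM except that the hypothesis `hDG0` (`𝔇(X′_k, X_k) ≤ 1_S1_S·m_X·e^{−ρ₂d}`) and the letter `m_X`
are REPLACED by file 36's inputs: the cut cube rows' η-defects `hDcut`∕`hDcutF`∕`hDcutB` (letters `m₀, m₁`), the bumps' two-grid fits `hfit₁`∕`hfit₁b`∕`hfit₂`∕`hfit₂b` (`o_{χ1}, o_{χ2}`), the
species' η-defect `hDV` (`o_V`); `m_X` becomes file 36's printed constant.  The cover (n15-c∕177) then produces only dag-n15-a's cube-cut defect rows (FILE 122b) and pointwise fits.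

HONEST FRAMING ∕ LIMITS.  Plumbing over LANDED theorems (one file-36 call); abstract carriers; nothing of [B5]∕[B6]∕[B9] asserted (Thm 3.14 pp.426–427 = difference TEMPLATE; (3.62)–(3.65)
shapes).  NE2 for non-abelian `G(U)` NOT proved (C-N15-1); N15 booked «discharged AS CONSUMED at the U-blind v7 pin» (№253) — road (c)'s typed home gains a brick, NO count; K3⁸ skeleton
untouched; one finite 𝕋⁴ at fixed ε — NOT infinite volume, NOT OS, NOT a mass gap, NOT Clay.  Restate-immune (no Theses import).
-/

noncomputable section

open scoped BigOperators Matrix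
open Finset

namespace Summit.QuantumFields.YangMills.BalabanUVNodes.N15.Gluing

open Literature.MathematicalPhysics.QuantumFieldTheory.Balaban1983to89
open Literature.MathematicalPhysics.QuantumFieldTheory.Balaban1983to89.B11SectG (BlockNorm HasMaj RowSum)
open Literature.MathematicalPhysics.QuantumFieldTheory.Balaban1983to89.B6RandomWalk (Triangle254)
open Literature.MathematicalPhysics.QuantumFieldTheory.Balaban1983to89.T4EtaRateDefect (idef)
open Literature.MathematicalPhysics.QuantumFieldTheory.Balaban1983to89.T4EtaRateCoeffDefect (pull diagK)
open Literature.MathematicalPhysics.QuantumFieldTheory.Balaban1983to89.B6Prop26Gluing (mulOp ind ind_nonneg)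
open Summit.QuantumFields.YangMills.BalabanUVNodes.N15.MatrixSpecies (mmulOp liftBlk liftMap liftEquiv)
open Summit.QuantumFields.YangMills.BalabanUVNodes.N15.BackgroundLayer (fgrad bgrad fgradAdj stack projO unstackM bgPropV blkPair liftPair fgradMat)
open Summit.QuantumFields.YangMills.BalabanUVNodes.N15.CurvedSpecies (hasMaj_idef_smoothCutDressed_loc₂)

variable {X X' ι J K : Type} [Fintype X] [Fintype X'] [DecidableEq X] [DecidableEq X'] [Fintype ι] [DecidableEq ι] [Fintype J] [DecidableEq J] [Fintype K] {g : B6.Geometry}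
  (blk : X → g.Site) (π : X' → X) (τ : J → X ≃ X) (τ' : J → X' ≃ X') (n n' : ℝ) (ν : J)
  {σ cr : ℝ} {N : K → (X × ι → ℝ) →ₗ[ℝ] (X × ι → ℝ)} {N' : K → (X' × ι → ℝ) →ₗ[ℝ] (X' × ι → ℝ)} {C : K → X → Matrix ι ι ℝ} {C' : K → X' → Matrix ι ι ℝ}
  {A : K → J ⊕ J → X → Matrix ι ι ℝ} {A' : K → J ⊕ J → X' → Matrix ι ι ℝ} {NV : K → (X × ι → ℝ) →ₗ[ℝ] (X × ι → ℝ)} {NV' : K → (X' × ι → ℝ) →ₗ[ℝ] (X' × ι → ℝ)}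
  {Δ NL Yop : (X × ι → ℝ) →ₗ[ℝ] (X × ι → ℝ)} {Δ' NL' Yop' : (X' × ι → ℝ) →ₗ[ℝ] (X' × ι → ℝ)} {Fl : K → (X × ι → ℝ) →ₗ[ℝ] (X × ι → ℝ)} {Fl' : K → (X' × ι → ℝ) →ₗ[ℝ] (X' × ι → ℝ)}
  {χX χtX ψX ψ₂X hX : K → X → ℝ} {χX' χtX' ψX' ψ₂X' hX' : K → X' → ℝ} {Sk : K → Set g.Site} {hb : K → g.Site → ℝ}
  {Tf Tb : K → J → (X × ι → ℝ) →ₗ[ℝ] (X × ι → ℝ)} {Tf' Tb' : K → J → (X' × ι → ℝ) →ₗ[ℝ] (X' × ι → ℝ)}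

set_option maxHeartbeats 4000000 in
/-- ★★★ **ENTRY 2 `Y∘∇⁻_ν` AT TWO SPACINGS FROM FLAT DATA, `𝔇(X′,X)` DERIVED** — n15-c∕174 with `hDG0`∕`m_X` replaced by dag-n15-w3 file 36's inputs (cut cube defects `m₀, m₁`, bump fits
`o_{χ1}, o_{χ2}`, species defect `o_V`).  Abstract carriers; nothing of [B9] asserted. [cite: Balaban1985BackgroundPropagators, Thm 3.14 pp.426–427 (η-rate: difference template), Thm 3.1
p.397 ((3.42) entry `G∇*`: shape), (3.62)–(3.65) pp.402–403; Balaban1984PropagatorsII, (2.133)–(2.136) p.247] -/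
theorem hasMaj_idef_rightInverse_bgrad_smoothCutDressed_of_flat_cut
    (htri : Triangle254 g)
    (hd : ∀ a b : g.Site, 0 ≤ g.dist a b)
    (hsymm : ∀ y y', g.dist y y' = g.dist y' y)
    (hd0 : ∀ y : g.Site, g.dist y y = 0)
    (hrow : RowSum g σ cr)
    (hσ : 0 ≤ σ)
    {ρ₁ ρ₂ ρ₃ ρN δV δN ε R c₀ c₁ c₂ o₀ o₁ o₂ o cN rN rA oAt RN rV ℓ ω β β₁ ct δ βQ θA m₀ m₁ oχ₁ oχ₂ oV mQ r𝒲 oχ θF εF rFK rFE os oχc rC r₁ εFl rFl mN mT oC og Nov : ℝ}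
    (hβ : 0 ≤ β)
    (hβ₁ : 0 ≤ β₁)
    (hβQ : 0 ≤ βQ)
    (hct : 0 ≤ ct)
    (hR : 0 ≤ R)
    (hcr : 0 ≤ cr)
    (hc₀ : 0 ≤ c₀)
    (hc₁ : 0 ≤ c₁)
    (hc₂ : 0 ≤ c₂)
    (ho₀ : 0 ≤ o₀)
    (ho₁ : 0 ≤ o₁)
    (ho₂ : 0 ≤ o₂)
    (ho : 0 ≤ o)
    (hcN : 0 ≤ cN)
    (hrN : 0 ≤ rN)
    (hrA : 0 ≤ rA)
    (hoAt : 0 ≤ oAt)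
    (hRN : 0 ≤ RN)
    (hrV : 0 ≤ rV)
    (hℓ : 0 ≤ ℓ)
    (hω : 0 ≤ ω)
    (hθA : 0 ≤ θA)
    (hm₀ : 0 ≤ m₀) (hm₁ : 0 ≤ m₁) (hoχ₁ : 0 ≤ oχ₁) (hoχ₂ : 0 ≤ oχ₂) (hoV : 0 ≤ oV)
    (hmQ : 0 ≤ mQ)
    (hr𝒲 : 0 ≤ r𝒲)
    (hoχ : 0 ≤ oχ)
    (hε : 0 < ε)
    (hθF : 0 ≤ θF)
    (hεF : 0 ≤ εF)
    (hrFK : 0 ≤ rFK)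
    (hrFE : 0 ≤ rFE)
    (hos : 0 ≤ os)
    (hoχc : 0 ≤ oχc)
    (hNov : 0 ≤ Nov)
    (hrC : 0 ≤ rC)
    (hr₁ : 0 ≤ r₁)
    (hεFl : 0 ≤ εFl)
    (hrFl : 0 ≤ rFl)
    (hmN : 0 ≤ mN)
    (hmT : 0 ≤ mT)
    (hoC : 0 ≤ oC)
    (hog : 0 ≤ og)
    (hσρ : σ ≤ ρ₁)
    (hρ₁V : ρ₁ ≤ δV)
    (hρ₁G : ρ₁ + σ ≤ δ)
    (hρ₂ : 0 ≤ ρ₂)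
    (hρ₂₁ : ρ₂ + σ ≤ ρ₁)
    (hρ₃ : 0 ≤ ρ₃)
    (hρ₃N : ρ₃ ≤ ρN)
    (hρ₃V : ρ₃ ≤ δN - ε)
    (hρ₃₂ : ρ₃ + σ ≤ ρ₂)
    (hρ₂W : ρ₂ + 2 * σ ≤ ρ₁)
    (hρ₁N : ρ₁ ≤ δN)
    (hσρ₃ : 2 * σ ≤ ρ₃)
    (hSχ : ∀ q, ∀ x, (χX q) x ≠ 0 → blk x ∈ (Sk q))
    (hSψ₂ : ∀ q, ∀ x, (ψ₂X q) x ≠ 0 → blk x ∈ (Sk q))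
    (hχt : ∀ q, ∀ x, |(χtX q) x| ≤ 1)
    (hdχt : ∀ q, ∀ μ p, |fgrad n (liftEquiv (τ μ) ι) (fun p : X × ι => (χtX q) p.1) p| ≤ ct)
    (hdχtb : ∀ q, ∀ μ p, |bgrad n (liftEquiv (τ μ) ι) (fun p : X × ι => (χtX q) p.1) p| ≤ ct)
    (hsub : ∀ q, mulOp (fun p : X × ι => (χtX q) p.1) ∘ₗ mulOp (fun p : X × ι => (χX q) p.1) = mulOp (fun p : X × ι => (χtX q) p.1))
    (hχ : ∀ q, mulOp (fun p : X × ι => (χX q) p.1) ∘ₗ mulOp (fun p : X × ι => (χtX q) p.1) = mulOp (fun p : X × ι => (χtX q) p.1))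
    (hs : ∀ q, ∀ μ, mulOp ((fun p : X × ι => (χtX q) p.1) ∘ (liftEquiv (τ μ) ι)) ∘ₗ mulOp (fun p : X × ι => (χX q) p.1) = mulOp ((fun p : X × ι => (χtX q) p.1) ∘ (liftEquiv (τ μ) ι)))
    (hsb : ∀ q, ∀ μ, mulOp ((fun p : X × ι => (χtX q) p.1) ∘ (liftEquiv (τ μ) ι).symm) ∘ₗ mulOp (fun p : X × ι => (χX q) p.1) = mulOp ((fun p : X × ι => (χtX q) p.1) ∘ (liftEquiv (τ μ) ι).symm))
    (hdd : ∀ q, ∀ μ, mulOp (fgrad n (liftEquiv (τ μ) ι) (fun p : X × ι => (χtX q) p.1)) ∘ₗ mulOp (fun p : X × ι => (χX q) p.1) = mulOp (fgrad n (liftEquiv (τ μ) ι) (fun p : X × ι => (χtX q) p.1)))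
    (hddb : ∀ q, ∀ μ, mulOp (bgrad n (liftEquiv (τ μ) ι) (fun p : X × ι => (χtX q) p.1)) ∘ₗ mulOp (fun p : X × ι => (χX q) p.1) = mulOp (bgrad n (liftEquiv (τ μ) ι) (fun p : X × ι => (χtX q) p.1)))
    (hSχ' : ∀ q, ∀ x', (χX' q) x' ≠ 0 → blk (π x') ∈ (Sk q))
    (hSψ' : ∀ q, ∀ x', (ψX' q) x' ≠ 0 → blk (π x') ∈ (Sk q))
    (hSψ₂' : ∀ q, ∀ x', (ψ₂X' q) x' ≠ 0 → blk (π x') ∈ (Sk q))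
    (hχt' : ∀ q, ∀ x', |(χtX' q) x'| ≤ 1)
    (hdχt' : ∀ q, ∀ μ p', |fgrad n' (liftEquiv (τ' μ) ι) (fun p : X' × ι => (χtX' q) p.1) p'| ≤ ct)
    (hdχtb' : ∀ q, ∀ μ p', |bgrad n' (liftEquiv (τ' μ) ι) (fun p : X' × ι => (χtX' q) p.1) p'| ≤ ct)
    (hsub' : ∀ q, mulOp (fun p : X' × ι => (χtX' q) p.1) ∘ₗ mulOp (fun p : X' × ι => (χX' q) p.1) = mulOp (fun p : X' × ι => (χtX' q) p.1))
    (hχ' : ∀ q, mulOp (fun p : X' × ι => (χX' q) p.1) ∘ₗ mulOp (fun p : X' × ι => (χtX' q) p.1) = mulOp (fun p : X' × ι => (χtX' q) p.1))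
    (hs' : ∀ q, ∀ μ, mulOp ((fun p : X' × ι => (χtX' q) p.1) ∘ (liftEquiv (τ' μ) ι)) ∘ₗ mulOp (fun p : X' × ι => (χX' q) p.1) = mulOp ((fun p : X' × ι => (χtX' q) p.1) ∘ (liftEquiv (τ' μ) ι)))
    (hsb' : ∀ q, ∀ μ, mulOp ((fun p : X' × ι => (χtX' q) p.1) ∘ (liftEquiv (τ' μ) ι).symm) ∘ₗ mulOp (fun p : X' × ι => (χX' q) p.1) = mulOp ((fun p : X' × ι => (χtX' q) p.1) ∘ (liftEquiv (τ' μ) ι).symm))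
    (hdd' : ∀ q, ∀ μ, mulOp (fgrad n' (liftEquiv (τ' μ) ι) (fun p : X' × ι => (χtX' q) p.1)) ∘ₗ mulOp (fun p : X' × ι => (χX' q) p.1) = mulOp (fgrad n' (liftEquiv (τ' μ) ι) (fun p : X' × ι => (χtX' q) p.1)))
    (hddb' : ∀ q, ∀ μ, mulOp (bgrad n' (liftEquiv (τ' μ) ι) (fun p : X' × ι => (χtX' q) p.1)) ∘ₗ mulOp (fun p : X' × ι => (χX' q) p.1) = mulOp (bgrad n' (liftEquiv (τ' μ) ι) (fun p : X' × ι => (χtX' q) p.1)))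
    (hNψ' : ∀ q, (N' q) ∘ₗ mulOp (fun p : X' × ι => (ψX' q) p.1) = (N' q))
    (hfitχ : ∀ q, ∀ x', |(χtX' q) x' - (χtX q) (π x')| ≤ oχ)
    (hcut : ∀ q, HasMaj (BlockNorm.ofBlocks g (liftBlk blk ι)) (BlockNorm.ofBlocks g (liftBlk blk ι)) (mulOp (fun p : X × ι => (χX q) p.1) ∘ₗ (N q)) (fun y y' => ind (Sk q) y * ind (Sk q) y' * (β * Real.exp (-(δ * g.dist y y')))))
    (hcutF : ∀ q, ∀ μ, HasMaj (BlockNorm.ofBlocks g (liftBlk blk ι)) (BlockNorm.ofBlocks g (liftBlk blk ι)) (mulOp (fun p : X × ι => (χX q) p.1) ∘ₗ (fgrad n (liftEquiv (τ μ) ι) ∘ₗ (N q)))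
      (fun y y' => ind (Sk q) y * ind (Sk q) y' * (β₁ * Real.exp (-(δ * g.dist y y')))))
    (hcutB : ∀ q, ∀ μ, HasMaj (BlockNorm.ofBlocks g (liftBlk blk ι)) (BlockNorm.ofBlocks g (liftBlk blk ι)) (mulOp (fun p : X × ι => (χX q) p.1) ∘ₗ (bgrad n (liftEquiv (τ μ) ι) ∘ₗ (N q)))
      (fun y y' => ind (Sk q) y * ind (Sk q) y' * (β₁ * Real.exp (-(δ * g.dist y y')))))
    (hcut' : ∀ q, HasMaj (BlockNorm.ofBlocks g (liftBlk (blk ∘ π) ι)) (BlockNorm.ofBlocks g (liftBlk (blk ∘ π) ι)) (mulOp (fun p : X' × ι => (χX' q) p.1) ∘ₗ (N' q)) (fun y y' => ind (Sk q) y * ind (Sk q) y' * (β * Real.exp (-(δ * g.dist y y')))))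
    (hcutF' : ∀ q, ∀ μ, HasMaj (BlockNorm.ofBlocks g (liftBlk (blk ∘ π) ι)) (BlockNorm.ofBlocks g (liftBlk (blk ∘ π) ι)) (mulOp (fun p : X' × ι => (χX' q) p.1) ∘ₗ (fgrad n' (liftEquiv (τ' μ) ι) ∘ₗ (N' q)))
      (fun y y' => ind (Sk q) y * ind (Sk q) y' * (β₁ * Real.exp (-(δ * g.dist y y')))))
    (hcutB' : ∀ q, ∀ μ, HasMaj (BlockNorm.ofBlocks g (liftBlk (blk ∘ π) ι)) (BlockNorm.ofBlocks g (liftBlk (blk ∘ π) ι)) (mulOp (fun p : X' × ι => (χX' q) p.1) ∘ₗ (bgrad n' (liftEquiv (τ' μ) ι) ∘ₗ (N' q)))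
      (fun y y' => ind (Sk q) y * ind (Sk q) y' * (β₁ * Real.exp (-(δ * g.dist y y')))))
    (hTf : ∀ q, ∀ μ, (N q) ∘ₗ fgrad n (liftEquiv (τ μ) ι) ∘ₗ mulOp (fun p : X × ι => (χX q) p.1) = (Tf q) μ ∘ₗ mulOp (fun p : X × ι => (χX q) p.1))
    (hTb : ∀ q, ∀ μ, (N q) ∘ₗ bgrad n (liftEquiv (τ μ) ι) ∘ₗ mulOp (fun p : X × ι => (χX q) p.1) = (Tb q) μ ∘ₗ mulOp (fun p : X × ι => (χX q) p.1))
    (hTf' : ∀ q, ∀ μ, (N' q) ∘ₗ fgrad n' (liftEquiv (τ' μ) ι) ∘ₗ mulOp (fun p : X' × ι => (χX' q) p.1) = (Tf' q) μ ∘ₗ mulOp (fun p : X' × ι => (χX' q) p.1))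
    (hTb' : ∀ q, ∀ μ, (N' q) ∘ₗ bgrad n' (liftEquiv (τ' μ) ι) ∘ₗ mulOp (fun p : X' × ι => (χX' q) p.1) = (Tb' q) μ ∘ₗ mulOp (fun p : X' × ι => (χX' q) p.1))
    (hTfr : ∀ q, ∀ μ, HasMaj (BlockNorm.ofBlocks g (liftBlk blk ι)) (BlockNorm.ofBlocks g (liftBlk blk ι)) ((Tf q) μ) (fun y y' => ind (Sk q) y * ind (Sk q) y' * (βQ * Real.exp (-(δ * g.dist y y')))))
    (hTbr : ∀ q, ∀ μ, HasMaj (BlockNorm.ofBlocks g (liftBlk blk ι)) (BlockNorm.ofBlocks g (liftBlk blk ι)) ((Tb q) μ) (fun y y' => ind (Sk q) y * ind (Sk q) y' * (βQ * Real.exp (-(δ * g.dist y y')))))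
    (hTfr' : ∀ q, ∀ μ, HasMaj (BlockNorm.ofBlocks g (liftBlk (blk ∘ π) ι)) (BlockNorm.ofBlocks g (liftBlk (blk ∘ π) ι)) ((Tf' q) μ) (fun y y' => ind (Sk q) y * ind (Sk q) y' * (βQ * Real.exp (-(δ * g.dist y y')))))
    (hTbr' : ∀ q, ∀ μ, HasMaj (BlockNorm.ofBlocks g (liftBlk (blk ∘ π) ι)) (BlockNorm.ofBlocks g (liftBlk (blk ∘ π) ι)) ((Tb' q) μ) (fun y y' => ind (Sk q) y * ind (Sk q) y' * (βQ * Real.exp (-(δ * g.dist y y')))))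
    (hTfψ : ∀ q, ∀ μ, (Tf q) μ ∘ₗ mulOp (fun p : X × ι => (ψ₂X q) p.1) = (Tf q) μ)
    (hTbψ : ∀ q, ∀ μ, (Tb q) μ ∘ₗ mulOp (fun p : X × ι => (ψ₂X q) p.1) = (Tb q) μ)
    (hTfψ' : ∀ q, ∀ μ, (Tf' q) μ ∘ₗ mulOp (fun p : X' × ι => (ψ₂X' q) p.1) = (Tf' q) μ)
    (hTbψ' : ∀ q, ∀ μ, (Tb' q) μ ∘ₗ mulOp (fun p : X' × ι => (ψ₂X' q) p.1) = (Tb' q) μ)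
    (hDTf : ∀ q, ∀ μ, HasMaj (BlockNorm.ofBlocks g (liftBlk blk ι)) (BlockNorm.ofBlocks g (liftBlk (blk ∘ π) ι)) (idef (pull (liftMap π ι)) (pull (liftMap π ι)) ((Tf' q) μ) ((Tf q) μ)) (fun y y' => mQ * Real.exp (-(δ * g.dist y y'))))
    (hDTb : ∀ q, ∀ μ, HasMaj (BlockNorm.ofBlocks g (liftBlk blk ι)) (BlockNorm.ofBlocks g (liftBlk (blk ∘ π) ι)) (idef (pull (liftMap π ι)) (pull (liftMap π ι)) ((Tb' q) μ) ((Tb q) μ)) (fun y y' => mQ * Real.exp (-(δ * g.dist y y'))))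
    (hV : ∀ q, HasMaj (BlockNorm.ofBlocks g (blkPair (liftBlk blk ι))) (BlockNorm.ofBlocks g (liftBlk blk ι)) (unstackM (C q) (A q) + (NV q) ∘ₗ projO (none : Option (J ⊕ J))) (fun y y' => R * Real.exp (-(δV * g.dist y y'))))
    (hV' : ∀ q, HasMaj (BlockNorm.ofBlocks g (blkPair (liftBlk (blk ∘ π) ι))) (BlockNorm.ofBlocks g (liftBlk (blk ∘ π) ι)) (unstackM (C' q) (A' q) + (NV' q) ∘ₗ projO (none : Option (J ⊕ J))) (fun y y' => R * Real.exp (-(δV * g.dist y y'))))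
    (hq : (β + (β₁ + ct * β)) * (R * cr) * cr < 1)
    (hqA : θA * cr < 1)
    (hθAle : β * rC + Fintype.card J * (2 * (βQ * rA + β * r₁)) + β * RN * cr ≤ θA)
    (hr𝒲le : (((β * oC + mN * rC) + Fintype.card J * (2 * ((βQ * oAt + mT * rA) + (β * og + mN * r₁))) + (β * rV + mN * RN) * cr) + oχ * (β * rC + Fintype.card J * (2 * (βQ * rA + β * r₁)) + β * RN * cr)) ≤ r𝒲)
    (hεFle : (1 - θA * cr)⁻¹ * εFl * cr ≤ εF)
    (hrFEle : (1 - θA * cr)⁻¹ * rFl * cr + (1 - θA * cr)⁻¹ * (r𝒲 * ((1 - θA * cr)⁻¹ * εFl * cr) * cr) * cr ≤ rFE)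
    -- dag-n15-w3 file 36's inputs replacing the displayed defect of the dressed cut cube: bump two-grid fits, the cut cube rows' η-defects, the species' η-defect
    (hfit₁ : ∀ q, ∀ μ p', |((fun p' : X' × ι => (χtX' q) p'.1) ∘ (liftEquiv (τ' μ) ι)) p' - ((fun p : X × ι => (χtX q) p.1) ∘ (liftEquiv (τ μ) ι)) (liftMap π ι p')| ≤ oχ₁)
    (hfit₁b : ∀ q, ∀ μ p', |((fun p' : X' × ι => (χtX' q) p'.1) ∘ (liftEquiv (τ' μ) ι).symm) p' - ((fun p : X × ι => (χtX q) p.1) ∘ (liftEquiv (τ μ) ι).symm) (liftMap π ι p')| ≤ oχ₁)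
    (hfit₂ : ∀ q, ∀ μ p', |fgrad n' (liftEquiv (τ' μ) ι) (fun p' : X' × ι => (χtX' q) p'.1) p' - fgrad n (liftEquiv (τ μ) ι) (fun p : X × ι => (χtX q) p.1) (liftMap π ι p')| ≤ oχ₂)
    (hfit₂b : ∀ q, ∀ μ p', |bgrad n' (liftEquiv (τ' μ) ι) (fun p' : X' × ι => (χtX' q) p'.1) p' - bgrad n (liftEquiv (τ μ) ι) (fun p : X × ι => (χtX q) p.1) (liftMap π ι p')| ≤ oχ₂)
    (hDcut : ∀ q, HasMaj (BlockNorm.ofBlocks g (liftBlk blk ι)) (BlockNorm.ofBlocks g (liftBlk blk ι ∘ liftMap π ι))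
      (idef (pull (liftMap π ι)) (pull (liftMap π ι)) (mulOp (fun p : X' × ι => (χX' q) p.1) ∘ₗ (N' q)) (mulOp (fun p : X × ι => (χX q) p.1) ∘ₗ (N q)))
      (fun y y' => ind (Sk q) y * ind (Sk q) y' * (m₀ * Real.exp (-(δ * g.dist y y')))))
    (hDcutF : ∀ q, ∀ μ, HasMaj (BlockNorm.ofBlocks g (liftBlk blk ι)) (BlockNorm.ofBlocks g (liftBlk blk ι ∘ liftMap π ι))
      (idef (pull (liftMap π ι)) (pull (liftMap π ι)) (mulOp (fun p : X' × ι => (χX' q) p.1) ∘ₗ (fgrad n' (liftEquiv (τ' μ) ι) ∘ₗ (N' q))) (mulOp (fun p : X × ι => (χX q) p.1) ∘ₗ (fgrad n (liftEquiv (τ μ) ι) ∘ₗ (N q))))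
      (fun y y' => ind (Sk q) y * ind (Sk q) y' * (m₁ * Real.exp (-(δ * g.dist y y')))))
    (hDcutB : ∀ q, ∀ μ, HasMaj (BlockNorm.ofBlocks g (liftBlk blk ι)) (BlockNorm.ofBlocks g (liftBlk blk ι ∘ liftMap π ι))
      (idef (pull (liftMap π ι)) (pull (liftMap π ι)) (mulOp (fun p : X' × ι => (χX' q) p.1) ∘ₗ (bgrad n' (liftEquiv (τ' μ) ι) ∘ₗ (N' q))) (mulOp (fun p : X × ι => (χX q) p.1) ∘ₗ (bgrad n (liftEquiv (τ μ) ι) ∘ₗ (N q))))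
      (fun y y' => ind (Sk q) y * ind (Sk q) y' * (m₁ * Real.exp (-(δ * g.dist y y')))))
    (hDV : ∀ q, HasMaj (BlockNorm.ofBlocks g (blkPair (liftBlk blk ι))) (BlockNorm.ofBlocks g (liftBlk (blk ∘ π) ι))
      (idef (pull (liftPair (liftMap π ι))) (pull (liftMap π ι)) (unstackM (C' q) (A' q) + (NV' q) ∘ₗ projO (none : Option (J ⊕ J))) (unstackM (C q) (A q) + (NV q) ∘ₗ projO (none : Option (J ⊕ J)))) (fun y y' => oV * Real.exp (-(δV * g.dist y y'))))
    (hhD : ∀ q, ∀ μ p, |(fgrad n (liftEquiv (τ μ) ι) (fun p : X × ι => (hX q) p.1) ∘ ⇑(liftEquiv (τ μ) ι).symm) p| ≤ c₁)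
    (hhB : ∀ q, ∀ μ p, |(bgrad n (liftEquiv (τ μ) ι) (fun p : X × ι => (hX q) p.1) ∘ ⇑(liftEquiv (τ μ) ι)) p| ≤ c₁)
    (hh2 : ∀ q, ∀ μ p, |fgradAdj n (liftEquiv (τ μ) ι) (fgrad n (liftEquiv (τ μ) ι) (fun p : X × ι => (hX q) p.1)) p| ≤ c₂)
    (hh2f : ∀ q, ∀ μ p, |(fgrad n (liftEquiv (τ μ) ι) (fgrad n (liftEquiv (τ μ) ι) (fun p : X × ι => (hX q) p.1)) ∘ ⇑(liftEquiv (τ μ) ι).symm) p| ≤ c₂)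
    (hh2b : ∀ q, ∀ μ p, |bgrad n (liftEquiv (τ μ) ι) (bgrad n (liftEquiv (τ μ) ι) (fun p : X × ι => (hX q) p.1) ∘ ⇑(liftEquiv (τ μ) ι)) p| ≤ c₂)
    (hfD : ∀ q, ∀ μ p', |(fgrad n' (liftEquiv (τ' μ) ι) (fun p : X' × ι => (hX' q) p.1) ∘ ⇑(liftEquiv (τ' μ) ι).symm) p' - (fgrad n (liftEquiv (τ μ) ι) (fun p : X × ι => (hX q) p.1) ∘ ⇑(liftEquiv (τ μ) ι).symm) (liftMap π ι p')| ≤ o₁)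
    (hfB : ∀ q, ∀ μ p', |(bgrad n' (liftEquiv (τ' μ) ι) (fun p : X' × ι => (hX' q) p.1) ∘ ⇑(liftEquiv (τ' μ) ι)) p' - (bgrad n (liftEquiv (τ μ) ι) (fun p : X × ι => (hX q) p.1) ∘ ⇑(liftEquiv (τ μ) ι)) (liftMap π ι p')| ≤ o₁)
    (hf2 : ∀ q, ∀ μ p', |fgradAdj n' (liftEquiv (τ' μ) ι) (fgrad n' (liftEquiv (τ' μ) ι) (fun p : X' × ι => (hX' q) p.1)) p' - fgradAdj n (liftEquiv (τ μ) ι) (fgrad n (liftEquiv (τ μ) ι) (fun p : X × ι => (hX q) p.1)) (liftMap π ι p')| ≤ o₂)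
    (hf2f : ∀ q, ∀ μ p', |(fgrad n' (liftEquiv (τ' μ) ι) (fgrad n' (liftEquiv (τ' μ) ι) (fun p : X' × ι => (hX' q) p.1)) ∘ ⇑(liftEquiv (τ' μ) ι).symm) p' -
      (fgrad n (liftEquiv (τ μ) ι) (fgrad n (liftEquiv (τ μ) ι) (fun p : X × ι => (hX q) p.1)) ∘ ⇑(liftEquiv (τ μ) ι).symm) (liftMap π ι p')| ≤ o₂)
    (hf2b : ∀ q, ∀ μ p', |bgrad n' (liftEquiv (τ' μ) ι) (bgrad n' (liftEquiv (τ' μ) ι) (fun p : X' × ι => (hX' q) p.1) ∘ ⇑(liftEquiv (τ' μ) ι)) p' -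
      bgrad n (liftEquiv (τ μ) ι) (bgrad n (liftEquiv (τ μ) ι) (fun p : X × ι => (hX q) p.1) ∘ ⇑(liftEquiv (τ μ) ι)) (liftMap π ι p')| ≤ o₂)
    (hh1 : ∀ q, ∀ μ x, |fgrad n (τ μ) (hX q) x| ≤ c₁)
    (hh1b : ∀ q, ∀ μ x, |bgrad n (τ μ) (hX q) x| ≤ c₁)
    (hh0 : ∀ q, ∀ μ x, |(hX q) (τ μ x) - (hX q) x| ≤ c₀)
    (hh1' : ∀ q, ∀ μ x', |fgrad n' (τ' μ) (hX' q) x'| ≤ c₁)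
    (hh1b' : ∀ q, ∀ μ x', |bgrad n' (τ' μ) (hX' q) x'| ≤ c₁)
    (hh0' : ∀ q, ∀ μ x', |(hX' q) (τ' μ x') - (hX' q) x'| ≤ c₀)
    (hf1 : ∀ q, ∀ μ x', |fgrad n' (τ' μ) (hX' q) x' - fgrad n (τ μ) (hX q) (π x')| ≤ o₁)
    (hf1b : ∀ q, ∀ μ x', |bgrad n' (τ' μ) (hX' q) x' - bgrad n (τ μ) (hX q) (π x')| ≤ o₁)
    (hf0 : ∀ q, ∀ μ x', |((hX' q) (τ' μ x') - (hX' q) x') - ((hX q) (τ μ (π x')) - (hX q) (π x'))| ≤ o₀)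
    (hf0b : ∀ q, ∀ μ x', |((hX' q) x' - (hX' q) ((τ' μ).symm x')) - ((hX q) (π x') - (hX q) ((τ μ).symm (π x')))| ≤ o₀)
    (hfit : ∀ q, ∀ x', |(hX' q) x' - (hX q) (π x')| ≤ o)
    (hLip : ∀ q, ∀ y y', |(hb q) y - (hb q) y'| ≤ ℓ * g.dist y y')
    (hrh : ∀ q, ∀ x, |(hX q) x - (hb q) (blk x)| ≤ ω)
    (hrh' : ∀ q, ∀ x', |(hX' q) x' - (hb q) (blk (π x'))| ≤ ω)
    (hlayf : ∀ q, ∀ μ x, (hX q) x ≠ (hX q) ((τ μ).symm x) → (χX q) x = 1)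
    (hlayb : ∀ q, ∀ μ x, (hX q) (τ μ x) ≠ (hX q) x → (χX q) x = 1)
    (hlayf' : ∀ q, ∀ μ x', (hX' q) x' ≠ (hX' q) ((τ' μ).symm x') → (χX' q) x' = 1)
    (hlayb' : ∀ q, ∀ μ x', (hX' q) (τ' μ x') ≠ (hX' q) x' → (χX' q) x' = 1)
    (hA : ∀ q, ∀ j x i, ∑ k, |(A q) j x i k| ≤ rA)
    (hfAb : ∀ q, ∀ μ x' i, ∑ k, |(A' q) (Sum.inl μ) ((τ' μ).symm x') i k - (A q) (Sum.inl μ) ((τ μ).symm (π x')) i k| ≤ oAt)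
    (hfAf : ∀ q, ∀ μ x' i, ∑ k, |(A' q) (Sum.inr μ) (τ' μ x') i k - (A q) (Sum.inr μ) (τ μ (π x')) i k| ≤ oAt)
    (hKN : ∀ q, HasMaj (BlockNorm.ofBlocks g (liftBlk blk ι)) (BlockNorm.ofBlocks g (liftBlk blk ι)) (commOp NL (fun p : X × ι => (hX q) p.1)) (fun y y' => cN * Real.exp (-(ρN * g.dist y y'))))
    (hDKN : ∀ q, HasMaj (BlockNorm.ofBlocks g (liftBlk blk ι)) (BlockNorm.ofBlocks g (liftBlk (blk ∘ π) ι))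
      (idef (pull (liftMap π ι)) (pull (liftMap π ι)) (commOp NL' (fun p : X' × ι => (hX' q) p.1)) (commOp NL (fun p : X × ι => (hX q) p.1))) (fun y y' => rN * Real.exp (-(ρN * g.dist y y'))))
    (hNV : ∀ q, HasMaj (BlockNorm.ofBlocks g (liftBlk blk ι)) (BlockNorm.ofBlocks g (liftBlk blk ι)) (NV q) (fun y y' => RN * Real.exp (-(δN * g.dist y y'))))
    (hNV' : ∀ q, HasMaj (BlockNorm.ofBlocks g (liftBlk (blk ∘ π) ι)) (BlockNorm.ofBlocks g (liftBlk (blk ∘ π) ι)) (NV' q) (fun y y' => RN * Real.exp (-(δN * g.dist y y'))))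
    (hDNV : ∀ q, HasMaj (BlockNorm.ofBlocks g (liftBlk blk ι)) (BlockNorm.ofBlocks g (liftBlk (blk ∘ π) ι)) (idef (pull (liftMap π ι)) (pull (liftMap π ι)) (NV' q) (NV q)) (fun y y' => rV * Real.exp (-(δN * g.dist y y'))))
    -- the cut cube rows' η-defect, the sandwiched right entries' cut η-defects, aligned box cuts, idempotent cuts, species letters at both grids and their fits (FILES 150∕151)
    (hIcut : ∀ q, HasMaj (BlockNorm.ofBlocks g (liftBlk blk ι)) (BlockNorm.ofBlocks g (liftBlk (blk ∘ π) ι)) (idef (pull (liftMap π ι)) (pull (liftMap π ι)) (mulOp (fun p : X' × ι => (χX' q) p.1) ∘ₗ (N' q)) (mulOp (fun p : X × ι => (χX q) p.1) ∘ₗ (N q))) (fun y y' => ind (Sk q) y * ind (Sk q) y' * (mN * Real.exp (-(δ * g.dist y y')))))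
    (hITf : ∀ q, ∀ μ, HasMaj (BlockNorm.ofBlocks g (liftBlk blk ι)) (BlockNorm.ofBlocks g (liftBlk (blk ∘ π) ι)) (idef (pull (liftMap π ι)) (pull (liftMap π ι)) (mulOp (fun p : X' × ι => (χX' q) p.1) ∘ₗ (Tf' q) μ) (mulOp (fun p : X × ι => (χX q) p.1) ∘ₗ (Tf q) μ)) (fun y y' => ind (Sk q) y * ind (Sk q) y' * (mT * Real.exp (-(δ * g.dist y y')))))
    (hITb : ∀ q, ∀ μ, HasMaj (BlockNorm.ofBlocks g (liftBlk blk ι)) (BlockNorm.ofBlocks g (liftBlk (blk ∘ π) ι)) (idef (pull (liftMap π ι)) (pull (liftMap π ι)) (mulOp (fun p : X' × ι => (χX' q) p.1) ∘ₗ (Tb' q) μ) (mulOp (fun p : X × ι => (χX q) p.1) ∘ₗ (Tb q) μ)) (fun y y' => ind (Sk q) y * ind (Sk q) y' * (mT * Real.exp (-(δ * g.dist y y')))))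
    (hχπ : ∀ q x', χX' q x' = χX q (π x'))
    (hχχ : ∀ q, mulOp (fun p : X × ι => (χX q) p.1) ∘ₗ mulOp (fun p : X × ι => (χX q) p.1) = mulOp (fun p : X × ι => (χX q) p.1))
    (hχχ' : ∀ q, mulOp (fun p : X' × ι => (χX' q) p.1) ∘ₗ mulOp (fun p : X' × ι => (χX' q) p.1) = mulOp (fun p : X' × ι => (χX' q) p.1))
    (hC : ∀ q x i, ∑ j, |(C q) x i j| ≤ rC)
    (hC' : ∀ q x' i, ∑ j, |(C' q) x' i j| ≤ rC)
    (hgAf : ∀ q μ x i, ∑ j, |fgradMat n (τ μ) ((A q) (Sum.inl μ)) x i j| ≤ r₁)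
    (hgAb : ∀ q μ x i, ∑ j, |fgradMat n (τ μ) ((A q) (Sum.inr μ)) x i j| ≤ r₁)
    (hgAf' : ∀ q μ x' i, ∑ j, |fgradMat n' (τ' μ) ((A' q) (Sum.inl μ)) x' i j| ≤ r₁)
    (hgAb' : ∀ q μ x' i, ∑ j, |fgradMat n' (τ' μ) ((A' q) (Sum.inr μ)) x' i j| ≤ r₁)
    (hfC : ∀ q x' i, ∑ j, |(C' q) x' i j - (C q) (π x') i j| ≤ oC)
    (hfgAf : ∀ q μ x' i, ∑ j, |fgradMat n' (τ' μ) ((A' q) (Sum.inl μ)) ((τ' μ).symm x') i j - fgradMat n (τ μ) ((A q) (Sum.inl μ)) ((τ μ).symm (π x')) i j| ≤ og)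
    (hfgAb : ∀ q μ x' i, ∑ j, |fgradMat n' (τ' μ) ((A' q) (Sum.inr μ)) x' i j - fgradMat n (τ μ) ((A q) (Sum.inr μ)) (π x') i j| ≤ og)
    -- per cube: coarse plateau support ∕ input cut (for the coarse cut row), sharp-cut letters and fit, the partition's absolute letters, its cut, the `ν`-shifted supports and fit
    (hSψ : ∀ q, ∀ x, (ψX q) x ≠ 0 → blk x ∈ (Sk q))
    (hNψ : ∀ q, (N q) ∘ₗ mulOp (fun p : X × ι => (ψX q) p.1) = (N q))
    (hχ1 : ∀ q x, |χX q x| ≤ 1)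
    (hχ1' : ∀ q x', |χX' q x'| ≤ 1)
    (hfitχc : ∀ q x', |χX' q x' - χX q (π x')| ≤ oχc)
    (hhabs : ∀ q x, |hX q x| ≤ 1)
    (hhabs' : ∀ q x', |hX' q x'| ≤ 1)
    (hhcut : ∀ q, mulOp (fun p : X × ι => (hX q) p.1) ∘ₗ mulOp (fun p : X × ι => (χX q) p.1) = mulOp (fun p : X × ι => (hX q) p.1))
    (hhcut' : ∀ q, mulOp (fun p : X' × ι => (hX' q) p.1) ∘ₗ mulOp (fun p : X' × ι => (χX' q) p.1) = mulOp (fun p : X' × ι => (hX' q) p.1))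
    (hlayν : ∀ q x, hX q (τ ν x) ≠ 0 → χX q x = 1)
    (hlayν' : ∀ q x', hX' q (τ' ν x') ≠ 0 → χX' q x' = 1)
    (hfits : ∀ q x', |hX' q (τ' ν x') - hX q (τ ν (π x'))| ≤ os)
    (hh2' : ∀ q, ∀ μ p', |fgradAdj n' (liftEquiv (τ' μ) ι) (fgrad n' (liftEquiv (τ' μ) ι) (fun p : X' × ι => (hX' q) p.1)) p'| ≤ c₂)
    (hh2f' : ∀ q, ∀ μ p', |fgrad n' (liftEquiv (τ' μ) ι) (fgrad n' (liftEquiv (τ' μ) ι) (fun p : X' × ι => (hX' q) p.1)) p'| ≤ c₂)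
    (hh2b' : ∀ q, ∀ μ p', |bgrad n' (liftEquiv (τ' μ) ι) (bgrad n' (liftEquiv (τ' μ) ι) (fun p : X' × ι => (hX' q) p.1) ∘ ⇑(liftEquiv (τ' μ) ι)) p'| ≤ c₂)
    (hA' : ∀ q, ∀ j x' i, ∑ k, |(A' q) j x' i k| ≤ rA)
    (hKN' : ∀ q, HasMaj (BlockNorm.ofBlocks g (liftBlk (blk ∘ π) ι)) (BlockNorm.ofBlocks g (liftBlk (blk ∘ π) ι)) (commOp NL' (fun p : X' × ι => (hX' q) p.1)) (fun y y' => cN * Real.exp (-(ρN * g.dist y y'))))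
    (hN : ∀ a, ∑ q, ind (Sk q) a ≤ Nov)
    -- THE GLOBAL OPERATORS = the cubes' common models at both grids (flat part minus GLOBAL species, no far defect); the cut flat cubes' right locality on the partitions with defects `Fl`, `Fl′`: cuts, rows, η-defect; species letters and fits for FILES 150∕151; partition of unity; right inverses; ONE smallness
    (h236 : ∀ p : X × ι, ∑ q, (fun p : X × ι => (hX q) p.1) p ^ 2 = 1)
    (h236' : ∀ p : X' × ι, ∑ q, (fun p : X' × ι => (hX' q) p.1) p ^ 2 = 1)
    (hY : Δ ∘ₗ Yop = LinearMap.id)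
    (hY' : Δ' ∘ₗ Yop' = LinearMap.id)
    (hcov₀ : ∀ q, Δ = lapOp n (fun μ => liftEquiv (τ μ) ι) 0 + NL - (unstackM ((C q)) ((A q)) + (NV q) ∘ₗ projO (none : Option (J ⊕ J))) ∘ₗ stack LinearMap.id (fun j => Sum.elim (fun μ => fgrad n (liftEquiv (τ μ) ι)) (fun μ => bgrad n (liftEquiv (τ μ) ι)) j))
    (hcov₀' : ∀ q, Δ' = lapOp n' (fun μ => liftEquiv (τ' μ) ι) 0 + NL' - (unstackM ((C' q)) ((A' q)) + (NV' q) ∘ₗ projO (none : Option (J ⊕ J))) ∘ₗ stack LinearMap.id (fun j => Sum.elim (fun μ => fgrad n' (liftEquiv (τ' μ) ι)) (fun μ => bgrad n' (liftEquiv (τ' μ) ι)) j))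
    (hflat : ∀ q, (mulOp (fun p : X × ι => (χtX q) p.1) ∘ₗ (N q)) ∘ₗ (lapOp n (fun μ => liftEquiv (τ μ) ι) 0 + NL) ∘ₗ mulOp (fun p : X × ι => (hX q) p.1) = mulOp (fun p : X × ι => (hX q) p.1) + Fl q)
    (hflat' : ∀ q, (mulOp (fun p : X' × ι => (χtX' q) p.1) ∘ₗ (N' q)) ∘ₗ (lapOp n' (fun μ => liftEquiv (τ' μ) ι) 0 + NL') ∘ₗ mulOp (fun p : X' × ι => (hX' q) p.1) = mulOp (fun p : X' × ι => (hX' q) p.1) + Fl' q)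
    (hFlχ : ∀ q, mulOp (fun p : X × ι => (χX q) p.1) ∘ₗ Fl q = Fl q)
    (hFlψ : ∀ q, Fl q ∘ₗ mulOp (fun p : X × ι => (ψ₂X q) p.1) = Fl q)
    (hFlχ' : ∀ q, mulOp (fun p : X' × ι => (χX' q) p.1) ∘ₗ Fl' q = Fl' q)
    (hFlψ' : ∀ q, Fl' q ∘ₗ mulOp (fun p : X' × ι => (ψ₂X' q) p.1) = Fl' q)
    (hFl : ∀ q, HasMaj (BlockNorm.ofBlocks g (liftBlk blk ι)) (BlockNorm.ofBlocks g (liftBlk blk ι)) (Fl q) (fun y y' => εFl * Real.exp (-(ρ₁ * g.dist y y'))))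
    (hFl' : ∀ q, HasMaj (BlockNorm.ofBlocks g (liftBlk (blk ∘ π) ι)) (BlockNorm.ofBlocks g (liftBlk (blk ∘ π) ι)) (Fl' q) (fun y y' => εFl * Real.exp (-(ρ₁ * g.dist y y'))))
    (hDFl : ∀ q, HasMaj (BlockNorm.ofBlocks g (liftBlk blk ι)) (BlockNorm.ofBlocks g (liftBlk (blk ∘ π) ι)) (idef (pull (liftMap π ι)) (pull (liftMap π ι)) (Fl' q) (Fl q)) (fun y y' => rFl * Real.exp (-(ρ₁ * g.dist y y'))))
    (hqL : Nov * ((((((Fintype.card J : ℝ) * (3 * ((β + (β₁ + ct * β)) * (1 - (β + (β₁ + ct * β)) * (R * cr) * cr)⁻¹ * c₂) + 2 * (((1 - θA * cr)⁻¹ * βQ * cr) * c₁)) + 0) + (β + (β₁ + ct * β)) * (1 - (β + (β₁ + ct * β)) * (R * cr) * cr)⁻¹ * cN * cr) + (((Fintype.card J : ℝ) * (2 * rA * (c₁ * ((β + (β₁ + ct * β)) * (1 - (β + (β₁ + ct * β)) * (R * cr) * cr)⁻¹) + c₀ * ((1 - θA * cr)⁻¹ * βQ * cr)))) + (β + (β₁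 + ct * β)) * (1 - (β + (β₁ + ct * β)) * (R * cr) * cr)⁻¹ * ((ℓ * (Real.exp 1 * ε)⁻¹ + 2 * ω) * RN) * cr)) + θF) + εF) * cr < 1) :
    HasMaj (BlockNorm.ofBlocks g (liftBlk blk ι)) (BlockNorm.ofBlocks g (liftBlk (blk ∘ π) ι))
      (idef (pull (liftMap π ι)) (pull (liftMap π ι)) (Yop' ∘ₗ bgrad n' (liftEquiv (τ' ν) ι)) (Yop ∘ₗ bgrad n (liftEquiv (τ ν) ι)))
      (fun y y' => (((1 - Nov * ((((((Fintype.card J : ℝ) * (3 * ((β + (β₁ + ct * β)) * (1 - (β + (β₁ + ct * β)) * (R * cr) * cr)⁻¹ * c₂) + 2 * (((1 - θA * cr)⁻¹ * βQ * cr) * c₁)) + 0) + (β + (β₁ + ct * β)) * (1 - (β + (β₁ + ct * β)) * (R * cr) * cr)⁻¹ * cN * cr) + (((Fintype.card J : ℝ) * (2 * rA * (c₁ * ((β + (β₁ + ct * β)) * (1 - (β + (β₁ + ct * β)) * (R * cr) * cr)⁻¹) + c₀ * ((1 - θA * cr)⁻¹ * βQ * cr)))) + (β + (β₁ + ct * β))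 * (1 - (β + (β₁ + ct * β)) * (R * cr) * cr)⁻¹ * ((ℓ * (Real.exp 1 * ε)⁻¹ + 2 * ω) * RN) * cr)) + θF) + εF) * cr)⁻¹ * (Nov * ((1 * ((1 - θA * cr)⁻¹ * βQ * cr) * os + 1 * (1 * ((1 - θA * cr)⁻¹ * (1 * mQ + oχ * βQ) * cr + (1 - θA * cr)⁻¹ * (r𝒲 * ((1 - θA * cr)⁻¹ * βQ * cr) * cr) * cr) + oχc * ((1 - θA * cr)⁻¹ * βQ * cr)) * 1 + o * ((1 - θA * cr)⁻¹ * βQ * cr) * 1) + (1 * ((β + (β₁ + ct * β)) * (1 - (β + (β₁ + ct * β)) * (R * cr) * cr)⁻¹) * o₁ + 1 * ((((m₀ + oχ * β) + (m₁ + oχ₁ * β₁ + ct * m₀ + oχ₂ * β)) * cr + 1 * (((m₀ + oχ * β) + (m₁ + oχ₁ * β₁ + ct * m₀ + oχ₂ * β)) * cr) * (R * ((β + (β₁ + ct * β)) * (1 - (β + (β₁ + ct * β)) * (R * cr) * cr)⁻¹) * cr) + (β + (β₁ + ct * β)) * oV * cr * ((β + (β₁ + ct * β)) * (1 - (β + (β₁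 + ct * β)) * (R * cr) * cr)⁻¹) * cr) * (1 - 1 * ((β + (β₁ + ct * β)) * (R * cr) * cr))⁻¹) * c₁ + o * ((β + (β₁ + ct * β)) * (1 - (β + (β₁ + ct * β)) * (R * cr) * cr)⁻¹) * c₁))) * cr +
          (1 - Nov * ((((((Fintype.card J : ℝ) * (3 * ((β + (β₁ + ct * β)) * (1 - (β + (β₁ + ct * β)) * (R * cr) * cr)⁻¹ * c₂) + 2 * (((1 - θA * cr)⁻¹ * βQ * cr) * c₁)) + 0) + (β + (β₁ + ct * β)) * (1 - (β + (β₁ + ct * β)) * (R * cr) * cr)⁻¹ * cN * cr) + (((Fintype.card J : ℝ) * (2 * rA * (c₁ * ((β + (β₁ + ct * β)) * (1 - (β + (β₁ + ct * β)) * (R * cr) * cr)⁻¹) + c₀ * ((1 - θA * cr)⁻¹ * βQ * cr)))) + (β + (β₁ + ct * β)) * (1 - (β + (β₁ + ct * β)) * (R * cr) * cr)⁻¹ * ((ℓ * (Real.exp 1 * ε)⁻¹ + 2 * ω) * RN) * cr)) + θF) + εF) * cr)⁻¹ * ((Nov * ((((((Fintype.card J : ℝ) * (3 * (((β + (β₁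 + ct * β)) * (1 - (β + (β₁ + ct * β)) * (R * cr) * cr)⁻¹) * o₂ + ((((m₀ + oχ * β) + (m₁ + oχ₁ * β₁ + ct * m₀ + oχ₂ * β)) * cr + 1 * (((m₀ + oχ * β) + (m₁ + oχ₁ * β₁ + ct * m₀ + oχ₂ * β)) * cr) * (R * ((β + (β₁ + ct * β)) * (1 - (β + (β₁ + ct * β)) * (R * cr) * cr)⁻¹) * cr) + (β + (β₁ + ct * β)) * oV * cr * ((β + (β₁ + ct * β)) * (1 - (β + (β₁ + ct * β)) * (R * cr) * cr)⁻¹) * cr) * (1 - 1 * ((β + (β₁ + ct * β)) * (R * cr) * cr))⁻¹) * c₂) + 2 * (((1 - θA * cr)⁻¹ * βQ * cr) * o₁ + ((1 - θA * cr)⁻¹ * (1 * mQ + oχ * βQ) * cr + (1 - θA * cr)⁻¹ * (r𝒲 * ((1 - θA * cr)⁻¹ * βQ * cr) * cr) * cr) * c₁)) + 0) + ((β + (β₁ + ct * β)) * (1 - (β + (β₁ + ct * β)) * (R * cr) * cr)⁻¹) * rN * cr + ((((m₀ + oχ * β) + (m₁ + oχ₁ * β₁ + ct * m₀ + oχ₂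 * β)) * cr + 1 * (((m₀ + oχ * β) + (m₁ + oχ₁ * β₁ + ct * m₀ + oχ₂ * β)) * cr) * (R * ((β + (β₁ + ct * β)) * (1 - (β + (β₁ + ct * β)) * (R * cr) * cr)⁻¹) * cr) + (β + (β₁ + ct * β)) * oV * cr * ((β + (β₁ + ct * β)) * (1 - (β + (β₁ + ct * β)) * (R * cr) * cr)⁻¹) * cr) * (1 - 1 * ((β + (β₁ + ct * β)) * (R * cr) * cr))⁻¹) * cN * cr + ((Fintype.card J : ℝ) * (2 * (rA * (c₁ * ((((m₀ + oχ * β) + (m₁ + oχ₁ * β₁ + ct * m₀ + oχ₂ * β)) * cr + 1 * (((m₀ + oχ * β) + (m₁ + oχ₁ * β₁ + ct * m₀ + oχ₂ * β)) * cr) * (R * ((β + (β₁ + ct * β)) * (1 - (β + (β₁ + ct * β)) * (R * cr) * cr)⁻¹) * cr) + (β + (β₁ + ct * β)) * oV * cr * ((β + (β₁ + ct * β)) * (1 - (β + (β₁ + ct * β)) * (R * cr) * cr)⁻¹) * cr) * (1 - 1 * ((β + (β₁ + ct * β)) * (R * cr) * cr))⁻¹) + o₁ * ((β + (β₁ + ct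 * β)) * (1 - (β + (β₁ + ct * β)) * (R * cr) * cr)⁻¹) + c₀ * ((1 - θA * cr)⁻¹ * (1 * mQ + oχ * βQ) * cr + (1 - θA * cr)⁻¹ * (r𝒲 * ((1 - θA * cr)⁻¹ * βQ * cr) * cr) * cr) + o₀ * ((1 - θA * cr)⁻¹ * βQ * cr)) + oAt * (c₁ * ((β + (β₁ + ct * β)) * (1 - (β + (β₁ + ct * β)) * (R * cr) * cr)⁻¹) + c₀ * ((1 - θA * cr)⁻¹ * βQ * cr)))) + ((β + (β₁ + ct * β)) * (1 - (β + (β₁ + ct * β)) * (R * cr) * cr)⁻¹) * (((ℓ * (Real.exp 1 * ε)⁻¹ + 2 * ω) * rV + 2 * o * RN)) * cr + ((((m₀ + oχ * β) + (m₁ + oχ₁ * β₁ + ct * m₀ + oχ₂ * β)) * cr + 1 * (((m₀ + oχ * β) + (m₁ + oχ₁ * β₁ + ct * m₀ + oχ₂ * β)) * cr) * (R * ((β + (β₁ + ct * β)) * (1 - (β + (β₁ + ct * β)) * (R * cr) * cr)⁻¹) * cr) + (β + (β₁ + ct * β)) * oV * cr * ((β + (β₁ + ct * β)) * (1 - (β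 + (β₁ + ct * β)) * (R * cr) * cr)⁻¹) * cr) * (1 - 1 * ((β + (β₁ + ct * β)) * (R * cr) * cr))⁻¹) * ((ℓ * (Real.exp 1 * ε)⁻¹ + 2 * ω) * RN) * cr))) + rFK) + o * (((((Fintype.card J : ℝ) * (3 * ((β + (β₁ + ct * β)) * (1 - (β + (β₁ + ct * β)) * (R * cr) * cr)⁻¹ * c₂) + 2 * (((1 - θA * cr)⁻¹ * βQ * cr) * c₁)) + 0) + (β + (β₁ + ct * β)) * (1 - (β + (β₁ + ct * β)) * (R * cr) * cr)⁻¹ * cN * cr) + (((Fintype.card J : ℝ) * (2 * rA * (c₁ * ((β + (β₁ + ct * β)) * (1 - (β + (β₁ + ct * β)) * (R * cr) * cr)⁻¹) + c₀ * ((1 - θA * cr)⁻¹ * βQ * cr)))) + (β + (β₁ + ct * β)) * (1 - (β + (β₁ + ct * β)) * (R * cr) * cr)⁻¹ * ((ℓ * (Real.exp 1 * ε)⁻¹ + 2 * ω) * RN) * cr)) + θF) + (1 * rFE + o * εF))) * ((1 - Nov * ((((((Fintype.card J : ℝ) * (3 * ((β + (β₁ + ct * β)) * (1 - (β + (β₁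 + ct * β)) * (R * cr) * cr)⁻¹ * c₂) + 2 * (((1 - θA * cr)⁻¹ * βQ * cr) * c₁)) + 0) + (β + (β₁ + ct * β)) * (1 - (β + (β₁ + ct * β)) * (R * cr) * cr)⁻¹ * cN * cr) + (((Fintype.card J : ℝ) * (2 * rA * (c₁ * ((β + (β₁ + ct * β)) * (1 - (β + (β₁ + ct * β)) * (R * cr) * cr)⁻¹) + c₀ * ((1 - θA * cr)⁻¹ * βQ * cr)))) + (β + (β₁ + ct * β)) * (1 - (β + (β₁ + ct * β)) * (R * cr) * cr)⁻¹ * ((ℓ * (Real.exp 1 * ε)⁻¹ + 2 * ω) * RN) * cr)) + θF) + εF) * cr)⁻¹ * (Nov * (((1 - θA * cr)⁻¹ * βQ * cr) * 1 + ((β + (β₁ + ct * β)) * (1 - (β + (β₁ + ct * β)) * (R * cr) * cr)⁻¹) * c₁)) * cr) * cr) * cr) *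
        Real.exp (-((ρ₃ - 2 * σ) * g.dist y y')))) := by
  have hBq : 0 < 1 - (β + (β₁ + ct * β)) * (R * cr) * cr := by linarith only [hq]
  have hBq1 : 0 < 1 - 1 * ((β + (β₁ + ct * β)) * (R * cr) * cr) := by linarith only [hq]
  have hmX36 : 0 ≤ ((((m₀ + oχ * β) + (m₁ + oχ₁ * β₁ + ct * m₀ + oχ₂ * β)) * cr + 1 * (((m₀ + oχ * β) + (m₁ + oχ₁ * β₁ + ct * m₀ + oχ₂ * β)) * cr) * (R * ((β + (β₁ + ct * β)) * (1 - (β + (β₁ + ct * β)) * (R * cr) * cr)⁻¹) * cr) + (β + (β₁ + ct * β)) * oV * cr * ((β + (β₁ + ct * β)) * (1 - (β + (β₁ + ct * β)) * (R * cr) * cr)⁻¹) * cr) * (1 - 1 * ((β + (β₁ + ct * β)) * (R * cr) * cr))⁻¹) := by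
    have hI1 : 0 ≤ (1 - (β + (β₁ + ct * β)) * (R * cr) * cr)⁻¹ := inv_nonneg.mpr hBq.le
    have hI2 : 0 ≤ (1 - 1 * ((β + (β₁ + ct * β)) * (R * cr) * cr))⁻¹ := inv_nonneg.mpr hBq1.le
    set I1 := (1 - (β + (β₁ + ct * β)) * (R * cr) * cr)⁻¹ with hI1def
    set I2 := (1 - 1 * ((β + (β₁ + ct * β)) * (R * cr) * cr))⁻¹ with hI2def
    positivity
  have HDG0 := fun q => hasMaj_idef_smoothCutDressed_loc₂ blk π τ τ' n n' htri hd hrow hσ hcr hβ hβ₁ hct hm₀ hm₁ hoχ hoχ₁ hoχ₂ hR hoV hσρ hρ₁V hρ₁G hρ₂ hρ₂₁ (hSχ q) (hSψ q) (hSχ' q) (hSψ' q) (hχt q) (hdχt q) (hdχtb q) (hsub q) (hχ q) (hs q) (hsb q) (hdd q) (hddb q) (hNψ q) (hχt' q) (hdχt' q) (hdχtb' q) (hsub' q) (hχ' q) (hs' q) (hsb' q) (hdd' q) (hddb' q) (hNψ' q) (hfitχ q) (hfit₁ q) (hfit₁b q) (hfit₂ q) (hfit₂b q) (hcut q) (hcutF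 q) (hcutB q) (hcut' q) (hcutF' q) (hcutB' q) (hDcut q) (hDcutF q) (hDcutB q) (hV q) (hV' q) (hDV q) hq
  exact hasMaj_idef_rightInverse_bgrad_smoothCutDressed_of_flat blk π τ τ' n n' ν htri hd hsymm hd0 hrow hσ hβ hβ₁ hβQ hct hR hcr hc₀ hc₁ hc₂ ho₀ ho₁ ho₂ ho hcN hrN hrA hoAt hRN hrV hℓ hω hθA hmX36 hmQ hr𝒲 hoχ hε hθF hεF hrFK hrFE hos hoχc hNov hrC hr₁ hεFl hrFl hmN hmT hoC hog hσρ hρ₁V hρ₁G hρ₂ hρ₂₁ hρ₃ hρ₃N hρ₃V hρ₃₂ hρ₂W hρ₁N hσρ₃ hSχ hSψ₂ hχt hdχt hdχtb hsub hχ hs hsb hdd hddb hSχ' hSψ' hSψ₂' hχt' hdχt' hdχtb' hsub' hχ' hs' hsb' hdd' hddb' hNψ' hfitχ hcut hcutF hcutB hcut' hcutF' hcutB' hTf hTb hTf' hTb' hTfr hTbr hTfr' hTbr' hTfψ hTbψ hTfψ' hTbψ' hDTf hDTb hV hV' hq hqA hθAle hr𝒲le hεFle hrFEle HDG0 hhD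 hhB hh2 hh2f hh2b hfD hfB hf2 hf2f hf2b hh1 hh1b hh0 hh1' hh1b' hh0' hf1 hf1b hf0 hf0b hfit hLip hrh hrh' hlayf hlayb hlayf' hlayb' hA hfAb hfAf hKN hDKN hNV hNV' hDNV hIcut hITf hITb hχπ hχχ hχχ' hC hC' hgAf hgAb hgAf' hgAb' hfC hfgAf hfgAb hSψ hNψ hχ1 hχ1' hfitχc hhabs hhabs' hhcut hhcut' hlayν hlayν' hfits hh2' hh2f' hh2b' hA' hKN' hN h236 h236' hY hY' hcov₀ hcov₀' hflat hflat' hFlχ hFlψ hFlχ' hFlψ' hFl hFl' hDFl hqL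

end Summit.QuantumFields.YangMills.BalabanUVNodes.N15.Gluing

end
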